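import Literature.Analysis.Complex.CartanHeftung
import Literature.Analysis.Complex.RungeUnits
import HarnessLib

/-!
# Cartan's Heftungslemma and Cartan's theorem on holomorphic matrices with box parameters

The user-facing forms of `Literature/Analysis/Complex/CartanHeftung.lean` (`cartan_heftung_polydisc`)
and `Literature/Analysis/Complex/CartanMatrices.lean` (`cartan_factorization_polydisc`) take the
parameters `z' ∈ ℂ^ι` in polydiscs. For the induction over the real coordinate directions of a box
(Grauert–Remmert, Kap. III §3; Cartan 1940) one needs the same statements with the parameters in
**boxes** `∏ (α_i, β_i) × (γ_i, δ_i) ⊂ ℂ^ι`, which is what this file provides: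

* `openBox p₀ ρ σ`, `closedBox p₀ ρ σ` — the open/closed boxes with centre `p₀` and half-widths
  `ρ` (real parts), `σ` (imaginary parts), and their elementary properties;
* `exists_box_cutoff_norm_le_one` — `C¹` product cut-offs (`ContDiffBump` in each real coordinate);
* `cartan_heftung_box` — GR Kap. III §1.3 Satz 4 (shrunken form) with box parameters, from the
  general `cartan_heftung`;
* `cartan_factorization_box` — Cartan's theorem (general invertible `c = c₁ c₂`) with box
  parameters, from `cartan_heftung_box` and `runge_units_rectangle_param` exactly as in
  `cartan_factorization_polydisc`.

## References

* H. Grauert, R. Remmert, *Theorie der Steinschen Räume* (1977), Kap. III §1.3 Satz 4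
  [GrauertRemmert1977].
* H. Cartan, *Sur les matrices holomorphes de `n` variables complexes*, J. Math. Pures Appl. 19
  (1940) 1–26, Théorème I [Cartan1940].
-/

noncomputable section

open Complex Set Filter Topology Metric

namespace Literature.Analysis.Complex

section Boxes

variable {ι : Type*}

/-- The open box `∏ᵢ (Re p₀ᵢ − ρᵢ, Re p₀ᵢ + ρᵢ) × (Im p₀ᵢ − σᵢ, Im p₀ᵢ + σᵢ) ⊂ ℂ^ι`. [folklore] -/
def openBox (p₀ : ι → ℂ) (ρ σ : ι → ℝ) : Set (ι → ℂ) :=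
  Set.pi univ fun i => Ioo ((p₀ i).re - ρ i) ((p₀ i).re + ρ i) ×ℂ Ioo ((p₀ i).im - σ i) ((p₀ i).im + σ i)

/-- The closed box `∏ᵢ [Re p₀ᵢ − ρᵢ, Re p₀ᵢ + ρᵢ] × [Im p₀ᵢ − σᵢ, Im p₀ᵢ + σᵢ] ⊂ ℂ^ι`. [folklore] -/
def closedBox (p₀ : ι → ℂ) (ρ σ : ι → ℝ) : Set (ι → ℂ) :=
  Set.pi univ fun i => Icc ((p₀ i).re - ρ i) ((p₀ i).re + ρ i) ×ℂ Icc ((p₀ i).im - σ i) ((p₀ i).im + σ i)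

/-- Membership in an open box is coordinatewise. [folklore] -/
theorem mem_openBox {p₀ : ι → ℂ} {ρ σ : ι → ℝ} {z : ι → ℂ} :
    z ∈ openBox p₀ ρ σ ↔ ∀ i, (p₀ i).re - ρ i < (z i).re ∧ (z i).re < (p₀ i).re + ρ i ∧
      (p₀ i).im - σ i < (z i).im ∧ (z i).im < (p₀ i).im + σ i := by
  simp only [openBox, mem_univ_pi, mem_reProdIm, mem_Ioo]
  exact forall_congr' fun i => by tauto

/-- Membership in a closed box is coordinatewise. [folklore] -/
theorem mem_closedBox {p₀ : ι → ℂ} {ρ σ : ι → ℝ} {z : ι → ℂ} :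
    z ∈ closedBox p₀ ρ σ ↔ ∀ i, (p₀ i).re - ρ i ≤ (z i).re ∧ (z i).re ≤ (p₀ i).re + ρ i ∧
      (p₀ i).im - σ i ≤ (z i).im ∧ (z i).im ≤ (p₀ i).im + σ i := by
  simp only [closedBox, mem_univ_pi, mem_reProdIm, mem_Icc]
  exact forall_congr' fun i => by tauto

/-- Open boxes are open (finitely many coordinates). [folklore] -/
theorem isOpen_openBox [Finite ι] (p₀ : ι → ℂ) (ρ σ : ι → ℝ) : IsOpen (openBox p₀ ρ σ) :=
  isOpen_set_pi finite_univ fun _ _ => isOpen_Ioo.reProdIm isOpen_Ioo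

/-- Closed boxes are compact. [folklore] -/
theorem isCompact_closedBox (p₀ : ι → ℂ) (ρ σ : ι → ℝ) : IsCompact (closedBox p₀ ρ σ) :=
  isCompact_univ_pi fun _ => isCompact_Icc.reProdIm isCompact_Icc

/-- Closed boxes are closed. [folklore] -/
theorem isClosed_closedBox (p₀ : ι → ℂ) (ρ σ : ι → ℝ) : IsClosed (closedBox p₀ ρ σ) :=
  isClosed_set_pi fun _ _ => isClosed_Icc.reProdIm isClosed_Icc

/-- Open boxes are convex. [folklore] -/
theorem convex_openBox (p₀ : ι → ℂ) (ρ σ : ι → ℝ) : Convex ℝ (openBox p₀ ρ σ) :=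
  convex_pi fun i _ => by
    have h : Ioo ((p₀ i).re - ρ i) ((p₀ i).re + ρ i) ×ℂ Ioo ((p₀ i).im - σ i) ((p₀ i).im + σ i) =
        Complex.reLm ⁻¹' Ioo ((p₀ i).re - ρ i) ((p₀ i).re + ρ i) ∩
          Complex.imLm ⁻¹' Ioo ((p₀ i).im - σ i) ((p₀ i).im + σ i) := by
      ext z; simp [mem_reProdIm]
    rw [h]
    exact ((convex_Ioo _ _).linear_preimage _).inter ((convex_Ioo _ _).linear_preimage _)

/-- Closed boxes are convex. [folklore] -/
theorem convex_closedBox (p₀ : ι → ℂ) (ρ σ : ι → ℝ) : Convex ℝ (closedBox p₀ ρ σ) :=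
  convex_pi fun i _ => by
    have h : Icc ((p₀ i).re - ρ i) ((p₀ i).re + ρ i) ×ℂ Icc ((p₀ i).im - σ i) ((p₀ i).im + σ i) =
        Complex.reLm ⁻¹' Icc ((p₀ i).re - ρ i) ((p₀ i).re + ρ i) ∩
          Complex.imLm ⁻¹' Icc ((p₀ i).im - σ i) ((p₀ i).im + σ i) := by
      ext z; simp [mem_reProdIm]
    rw [h]
    exact ((convex_Icc _ _).linear_preimage _).inter ((convex_Icc _ _).linear_preimage _)

/-- Open boxes are monotone in the half-widths. [folklore] -/
theorem openBox_mono (p₀ : ι → ℂ) {ρ ρ' σ σ' : ι → ℝ} (hρ : ∀ i, ρ' i ≤ ρ i) (hσ : ∀ i, σ' i ≤ σ i) :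
    openBox p₀ ρ' σ' ⊆ openBox p₀ ρ σ := fun z hz => by
  rw [mem_openBox] at hz ⊢
  intro i
  obtain ⟨h1, h2, h3, h4⟩ := hz i
  exact ⟨by linarith [hρ i], by linarith [hρ i], by linarith [hσ i], by linarith [hσ i]⟩

/-- An open box lies in the closed box with the same half-widths. [folklore] -/
theorem openBox_subset_closedBox (p₀ : ι → ℂ) (ρ σ : ι → ℝ) :
    openBox p₀ ρ σ ⊆ closedBox p₀ ρ σ := fun z hz => by
  rw [mem_openBox] at hz
  rw [mem_closedBox]
  intro i
  obtain ⟨h1, h2, h3, h4⟩ := hz i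
  exact ⟨h1.le, h2.le, h3.le, h4.le⟩

/-- A closed box lies in every open box with larger half-widths. [folklore] -/
theorem closedBox_subset_openBox (p₀ : ι → ℂ) {ρ ρ' σ σ' : ι → ℝ} (hρ : ∀ i, ρ' i < ρ i)
    (hσ : ∀ i, σ' i < σ i) : closedBox p₀ ρ' σ' ⊆ openBox p₀ ρ σ := fun z hz => by
  rw [mem_closedBox] at hz
  rw [mem_openBox]
  intro i
  obtain ⟨h1, h2, h3, h4⟩ := hz i
  exact ⟨by linarith [hρ i], by linarith [hρ i], by linarith [hσ i], by linarith [hσ i]⟩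

/-- **Product cut-offs for boxes with values of norm `≤ 1`**: for half-widths `0 < ρ'ᵢ < ρ''ᵢ`,
`0 < σ'ᵢ < σ''ᵢ` a `C¹` compactly supported `χ` on `ℂ^ι`, `= 1` on the closed box of half-widths
`(ρ', σ')`, supported in the closed box of half-widths `(ρ'', σ'')`, `‖χ‖ ≤ 1` (a product of
`ContDiffBump`s in the real and imaginary parts of the coordinates). [folklore] -/
theorem exists_box_cutoff_norm_le_one [Fintype ι] (p₀ : ι → ℂ) {ρ' ρ'' σ' σ'' : ι → ℝ}
    (hρ' : ∀ i, 0 < ρ' i) (hρ : ∀ i, ρ' i < ρ'' i) (hσ' : ∀ i, 0 < σ' i) (hσ : ∀ i, σ' i < σ'' i) :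
    ∃ χ : (ι → ℂ) → ℂ, ContDiff ℝ 1 χ ∧ HasCompactSupport χ ∧
      tsupport χ ⊆ closedBox p₀ ρ'' σ'' ∧ (∀ z ∈ closedBox p₀ ρ' σ', χ z = 1) ∧ ∀ z, ‖χ z‖ ≤ 1 := by
  let bre : ∀ i : ι, ContDiffBump ((p₀ i).re) := fun i ↦ ⟨ρ' i, ρ'' i, hρ' i, hρ i⟩
  let bim : ∀ i : ι, ContDiffBump ((p₀ i).im) := fun i ↦ ⟨σ' i, σ'' i, hσ' i, hσ i⟩
  set χ : (ι → ℂ) → ℂ := fun z ↦ ∏ i, (((bre i) (z i).re * (bim i) (z i).im : ℝ) : ℂ) with hχ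
  have hsupp : ∀ z : ι → ℂ, χ z ≠ 0 → z ∈ closedBox p₀ ρ'' σ'' := by
    intro z hz
    rw [mem_closedBox]
    intro i
    have h : ((bre i) (z i).re * (bim i) (z i).im : ℝ) ≠ 0 := fun h0 ↦
      hz (Finset.prod_eq_zero (Finset.mem_univ i) (by rw [h0, ofReal_zero]))
    have h1 : (z i).re ∈ Function.support (bre i) := left_ne_zero_of_mul h
    have h2 : (z i).im ∈ Function.support (bim i) := right_ne_zero_of_mul h
    rw [(bre i).support_eq, Real.ball_eq_Ioo] at h1
    rw [(bim i).support_eq, Real.ball_eq_Ioo] at h2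
    exact ⟨h1.1.le, h1.2.le, h2.1.le, h2.2.le⟩
  refine ⟨χ, ?_, ?_, ?_, ?_, ?_⟩
  · refine contDiff_prod fun i _ ↦ ofRealCLM.contDiff.comp ?_
    exact ((bre i).contDiff.comp (reCLM.contDiff.comp (contDiff_apply ℝ ℂ i))).mul
      ((bim i).contDiff.comp (imCLM.contDiff.comp (contDiff_apply ℝ ℂ i)))
  · exact HasCompactSupport.of_support_subset_isCompact (isCompact_closedBox p₀ ρ'' σ'')
      fun z hz ↦ hsupp z hz
  · exact closure_minimal (fun z hz ↦ hsupp z hz) (isClosed_closedBox p₀ ρ'' σ'')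
  · intro z hz
    rw [mem_closedBox] at hz
    refine Finset.prod_eq_one fun i _ ↦ ?_
    obtain ⟨h1, h2, h3, h4⟩ := hz i
    rw [(bre i).one_of_mem_closedBall (by rw [Real.closedBall_eq_Icc]; exact ⟨h1, h2⟩),
      (bim i).one_of_mem_closedBall (by rw [Real.closedBall_eq_Icc]; exact ⟨h3, h4⟩)]
    simp
  · intro z
    simp only [hχ]
    rw [norm_prod]
    exact Finset.prod_le_one (fun i _ ↦ norm_nonneg _) fun i _ ↦ by
      rw [norm_real, Real.norm_of_nonneg (mul_nonneg (bre i).nonneg (bim i).nonneg)]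
      exact mul_le_one₀ (bre i).le_one (bim i).nonneg (bim i).le_one

end Boxes

/-! ### Cartan's Heftungslemma with box parameters -/

section Cartan

variable {ι : Type*} [Fintype ι]
  {𝔄 : Type*} [NormedRing 𝔄] [NormedAlgebra ℂ 𝔄] [CompleteSpace 𝔄] [NormOneClass 𝔄]

omit [Fintype ι] in
/-- Half-widths of the decreasing parameter boxes: `ρₙ = ρ∞ + (ρ − ρ∞)/2ⁿ`. [folklore] -/
theorem halfwidth_facts {r rinf : ι → ℝ} (hrinf : ∀ i, 0 < rinf i) (hr : ∀ i, rinf i < r i)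
    (n : ℕ) (i : ι) :
    rinf i < rinf i + (r i - rinf i) / 2 ^ n ∧
      rinf i + (r i - rinf i) / 2 ^ (n + 1) < rinf i + (r i - rinf i) / 2 ^ n ∧
      0 < rinf i + (r i - rinf i) / 2 ^ (n + 1) := by
  have h1 : 0 < r i - rinf i := sub_pos.2 (hr i)
  have h2 : (0 : ℝ) < 2 ^ n := by positivity
  refine ⟨by have := div_pos h1 h2; linarith, ?_, by have := hrinf i; positivity⟩
  have : (r i - rinf i) / 2 ^ (n + 1) < (r i - rinf i) / 2 ^ n := by
    rw [pow_succ]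
    exact div_lt_div_of_pos_left h1 h2 (by linarith)
  linarith

/-- **Cartan's Heftungslemma with box parameters (GR Kap. III §1.3, Satz 4, shrunken form).**
As `cartan_heftung_polydisc`, with the parameter polydiscs `D(p₀, r) ⊃ D(p₀, r∞)` replaced by the
open boxes `openBox p₀ ρ σ ⊃ openBox p₀ ρ∞ σ∞` (`0 < ρ∞ < ρ`, `0 < σ∞ < σ` coordinatewise): there are
`K ≥ 1`, `β₀ > 0` such that every holomorphic `a` with `‖a − 1‖ ≤ N ≤ β₀` on
`{a' < x < b', c < y < d} × openBox p₀ ρ σ` is a product `c₁ c₂` of holomorphic invertible functions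
on `{a < x < b', c + 2ε < y < d − 2ε} × openBox p₀ ρ∞ σ∞` and `{a' < x < b, …} × openBox p₀ ρ∞ σ∞` with
`‖cᵢ − 1‖ ≤ 4KN`. [cite: GrauertRemmert1977, Kap. III §1.3 Satz 4] -/
theorem cartan_heftung_box {a a' b' b δ : ℝ} (haa' : a ≤ a') (hb'b : b' ≤ b) (hδ : 0 < δ)
    (hab : a' + δ < b' - δ) {c d ε : ℝ} (hε : 0 < ε) (hcd : c + 2 * ε ≤ d - 2 * ε)
    (p₀ : ι → ℂ) {ρ ρinf σ σinf : ι → ℝ} (hρinf : ∀ i, 0 < ρinf i) (hρ : ∀ i, ρinf i < ρ i)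
    (hσinf : ∀ i, 0 < σinf i) (hσ : ∀ i, σinf i < σ i) :
    ∃ K β₀ : ℝ, 1 ≤ K ∧ 0 < β₀ ∧ ∀ (af : ℂ × (ι → ℂ) → 𝔄) (N : ℝ), 0 ≤ N → N ≤ β₀ →
      DifferentiableOn ℂ af {z : ℂ × (ι → ℂ) | a' < z.1.re ∧ z.1.re < b' ∧ c < z.1.im ∧
        z.1.im < d ∧ z.2 ∈ openBox p₀ ρ σ} →
      (∀ z : ℂ × (ι → ℂ), a' < z.1.re → z.1.re < b' → c < z.1.im → z.1.im < d →
        z.2 ∈ openBox p₀ ρ σ → ‖af z - 1‖ ≤ N) →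
      ∃ c₁ c₂ : ℂ × (ι → ℂ) → 𝔄,
        DifferentiableOn ℂ c₁ {z : ℂ × (ι → ℂ) | a < z.1.re ∧ z.1.re < b' ∧ c + 2 * ε < z.1.im ∧
          z.1.im < d - 2 * ε ∧ z.2 ∈ openBox p₀ ρinf σinf} ∧
        DifferentiableOn ℂ c₂ {z : ℂ × (ι → ℂ) | a' < z.1.re ∧ z.1.re < b ∧ c + 2 * ε < z.1.im ∧
          z.1.im < d - 2 * ε ∧ z.2 ∈ openBox p₀ ρinf σinf} ∧
        (∀ z : ℂ × (ι → ℂ), a < z.1.re → z.1.re < b' → c + 2 * ε < z.1.im → z.1.im < d - 2 * ε →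
          z.2 ∈ openBox p₀ ρinf σinf → IsUnit (c₁ z) ∧ ‖c₁ z - 1‖ ≤ 4 * K * N) ∧
        (∀ z : ℂ × (ι → ℂ), a' < z.1.re → z.1.re < b → c + 2 * ε < z.1.im → z.1.im < d - 2 * ε →
          z.2 ∈ openBox p₀ ρinf σinf → IsUnit (c₂ z) ∧ ‖c₂ z - 1‖ ≤ 4 * K * N) ∧
        (∀ z : ℂ × (ι → ℂ), a' < z.1.re → z.1.re < b' → c + 2 * ε < z.1.im → z.1.im < d - 2 * ε →
          z.2 ∈ openBox p₀ ρinf σinf → af z = c₁ z * c₂ z) := by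
  classical
  -- the Cousin constant, enlarged to `K ≥ 1`
  obtain ⟨K₀, hK₀0, hK₀⟩ := cousin_heftung (P := ι → ℂ) (F := 𝔄) haa' hb'b hδ hab
    (abs_nonneg (d - c))
  set K : ℝ := max K₀ 1 with hKdef
  have hK1 : 1 ≤ K := le_max_right _ _
  have hK0K : K₀ ≤ K := le_max_left _ _
  have hK : ∀ (c' d' ε' : ℝ) (f : ℂ × (ι → ℂ) → 𝔄) (U U₁ : Set (ι → ℂ)) (χ₃ : (ι → ℂ) → ℂ)
      (N : ℝ), |d' - c'| ≤ |d - c| → 0 < ε' →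
      IsOpen U → IsOpen U₁ → ContDiff ℝ 1 χ₃ → HasCompactSupport χ₃ → tsupport χ₃ ⊆ U →
      (∀ p ∈ U₁, χ₃ p = 1) → (∀ p, ‖χ₃ p‖ ≤ 1) → 0 ≤ N →
      DifferentiableOn ℂ f
        {z : ℂ × (ι → ℂ) | a' < z.1.re ∧ z.1.re < b' ∧ c' < z.1.im ∧ z.1.im < d' ∧ z.2 ∈ U} →
      (∀ z : ℂ × (ι → ℂ), a' < z.1.re → z.1.re < b' → c' < z.1.im → z.1.im < d' → z.2 ∈ U →
        ‖f z‖ ≤ N) →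
      ∃ f' f'' : ℂ × (ι → ℂ) → 𝔄,
        DifferentiableOn ℂ f'
          {z : ℂ × (ι → ℂ) | z.1.re < b' ∧ c' + 2 * ε' < z.1.im ∧ z.1.im < d' - 2 * ε' ∧
            z.2 ∈ U₁} ∧
        DifferentiableOn ℂ f''
          {z : ℂ × (ι → ℂ) | a' < z.1.re ∧ c' + 2 * ε' < z.1.im ∧ z.1.im < d' - 2 * ε' ∧
            z.2 ∈ U₁} ∧
        (∀ z : ℂ × (ι → ℂ), a' < z.1.re → z.1.re < b' → c' + 2 * ε' < z.1.im →
          z.1.im < d' - 2 * ε' → z.2 ∈ U₁ → f z = f' z + f'' z) ∧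
        (∀ z : ℂ × (ι → ℂ), a < z.1.re → z.1.re < b' → c' < z.1.im → z.1.im < d' →
          ‖f' z‖ ≤ K * N) ∧
        (∀ z : ℂ × (ι → ℂ), a' < z.1.re → z.1.re < b → c' < z.1.im → z.1.im < d' →
          ‖f'' z‖ ≤ K * N) := by
    intro c' d' ε' f U U₁ χ₃ N h1 h2 h3 h4 h5 h6 h7 h8 h9 h10 h11 h12
    obtain ⟨f', f'', q1, q2, q3, q4, q5⟩ := hK₀ c' d' ε' f U U₁ χ₃ N h1 h2 h3 h4 h5 h6 h7 h8 h9
      h10 h11 h12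
    exact ⟨f', f'', q1, q2, q3,
      fun z w1 w2 w3 w4 ↦ (q4 z w1 w2 w3 w4).trans (mul_le_mul_of_nonneg_right hK0K h10),
      fun z w1 w2 w3 w4 ↦ (q5 z w1 w2 w3 w4).trans (mul_le_mul_of_nonneg_right hK0K h10)⟩
  -- the half-widths, boxes and cut-offs
  set ρs : ℕ → ι → ℝ := fun n i ↦ ρinf i + (ρ i - ρinf i) / 2 ^ n with hρs
  set σs : ℕ → ι → ℝ := fun n i ↦ σinf i + (σ i - σinf i) / 2 ^ n with hσs
  have hρs0 : ρs 0 = ρ := by funext i; simp [hρs]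
  have hσs0 : σs 0 = σ := by funext i; simp [hσs]
  obtain hρfacts := fun n i ↦ halfwidth_facts hρinf hρ n i
  obtain hσfacts := fun n i ↦ halfwidth_facts hσinf hσ n i
  have hχex : ∀ n : ℕ, ∃ χ : (ι → ℂ) → ℂ, ContDiff ℝ 1 χ ∧ HasCompactSupport χ ∧
      tsupport χ ⊆ closedBox p₀ (fun i ↦ (ρs n i + ρs (n + 1) i) / 2)
        (fun i ↦ (σs n i + σs (n + 1) i) / 2) ∧
      (∀ z ∈ closedBox p₀ (ρs (n + 1)) (σs (n + 1)), χ z = 1) ∧ ∀ z, ‖χ z‖ ≤ 1 := fun n ↦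
    exists_box_cutoff_norm_le_one p₀ (fun i ↦ (hρfacts n i).2.2)
      (fun i ↦ by
        have := (hρfacts n i).2.1
        change ρs (n + 1) i < (ρs n i + ρs (n + 1) i) / 2
        linarith)
      (fun i ↦ (hσfacts n i).2.2)
      (fun i ↦ by
        have := (hσfacts n i).2.1
        change σs (n + 1) i < (σs n i + σs (n + 1) i) / 2
        linarith)
  choose χ hχd hχc hχsupp hχ1 hχle using hχex
  set U : ℕ → Set (ι → ℂ) := fun n ↦ openBox p₀ (ρs n) (σs n) with hU
  have hUo : ∀ n, IsOpen (U n) := fun n ↦ isOpen_openBox p₀ (ρs n) (σs n)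
  have hχU : ∀ n, tsupport (χ n) ⊆ U n := fun n ↦
    (hχsupp n).trans (closedBox_subset_openBox p₀
      (fun i ↦ by
        have := (hρfacts n i).2.1
        change (ρs n i + ρs (n + 1) i) / 2 < ρs n i
        linarith)
      (fun i ↦ by
        have := (hσfacts n i).2.1
        change (σs n i + σs (n + 1) i) / 2 < σs n i
        linarith))
  have hχ1' : ∀ n, ∀ p ∈ U (n + 1), χ n p = 1 := fun n p hp ↦
    hχ1 n p (openBox_subset_closedBox p₀ (ρs (n + 1)) (σs (n + 1)) hp)
  have hUinf : ∀ n, openBox p₀ ρinf σinf ⊆ U n := fun n ↦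
    openBox_mono p₀ (fun i ↦ (hρfacts n i).1.le) (fun i ↦ (hσfacts n i).1.le)
  -- the constants
  have hK0 : 0 < K := by linarith
  refine ⟨K, 1 / (8 * K ^ 2), hK1, by positivity, ?_⟩
  intro af N hN hNβ haf hafN
  have hsmall : 8 * K ^ 2 * N ≤ 1 := by
    have h := mul_le_mul_of_nonneg_left hNβ (by positivity : (0 : ℝ) ≤ 8 * K ^ 2)
    rwa [mul_one_div_cancel (by positivity)] at h
  have haf' : DifferentiableOn ℂ af {z : ℂ × (ι → ℂ) | a' < z.1.re ∧ z.1.re < b' ∧ c < z.1.im ∧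
      z.1.im < d ∧ z.2 ∈ U 0} := by
    simp only [hU, hρs0, hσs0]; exact haf
  have hafN' : ∀ z : ℂ × (ι → ℂ), a' < z.1.re → z.1.re < b' → c < z.1.im → z.1.im < d →
      z.2 ∈ U 0 → ‖af z - 1‖ ≤ N := by
    simp only [hU, hρs0, hσs0]; exact hafN
  exact cartan_heftung (P := ι → ℂ) haa' hb'b hK1 hK hε hcd le_rfl hN hsmall hUo hχd hχc hχU
    hχ1' hχle (isOpen_openBox p₀ ρinf σinf) hUinf haf' hafN'

/-! ### Cartan's theorem on holomorphic matrices with box parameters -/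

omit [Fintype ι] in
/-- The open box `{α < x < β, γ < y < δ'} × openBox p₀ ρ σ ⊆ ℂ × ℂ^ι` is open. [folklore] -/
theorem isOpen_box_prod_openBox [Finite ι] (α β γ δ' : ℝ) (p₀ : ι → ℂ) (ρ σ : ι → ℝ) :
    IsOpen {z : ℂ × (ι → ℂ) | α < z.1.re ∧ z.1.re < β ∧ γ < z.1.im ∧ z.1.im < δ' ∧
      z.2 ∈ openBox p₀ ρ σ} := by
  have h : {z : ℂ × (ι → ℂ) | α < z.1.re ∧ z.1.re < β ∧ γ < z.1.im ∧ z.1.im < δ' ∧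
      z.2 ∈ openBox p₀ ρ σ} =
      (Prod.fst ⁻¹' (Ioo α β ×ℂ Ioo γ δ')) ∩ (Prod.snd ⁻¹' openBox p₀ ρ σ) := by
    ext z; simp only [mem_setOf_eq, mem_inter_iff, mem_preimage, mem_reProdIm, mem_Ioo]; tauto
  rw [h]
  exact ((isOpen_Ioo.reProdIm isOpen_Ioo).preimage continuous_fst).inter
    ((isOpen_openBox p₀ ρ σ).preimage continuous_snd)

omit [Fintype ι] in
/-- The open box `{α < x < β, γ < y < δ'} × openBox p₀ ρ σ` is convex. [folklore] -/
theorem convex_box_prod_openBox (α β γ δ' : ℝ) (p₀ : ι → ℂ) (ρ σ : ι → ℝ) :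
    Convex ℝ {z : ℂ × (ι → ℂ) | α < z.1.re ∧ z.1.re < β ∧ γ < z.1.im ∧ z.1.im < δ' ∧
      z.2 ∈ openBox p₀ ρ σ} := by
  have h : {z : ℂ × (ι → ℂ) | α < z.1.re ∧ z.1.re < β ∧ γ < z.1.im ∧ z.1.im < δ' ∧
      z.2 ∈ openBox p₀ ρ σ} =
      ((Complex.reLm.comp (LinearMap.fst ℝ ℂ (ι → ℂ))) ⁻¹' Ioo α β ∩
        (Complex.imLm.comp (LinearMap.fst ℝ ℂ (ι → ℂ))) ⁻¹' Ioo γ δ') ∩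
      (LinearMap.snd ℝ ℂ (ι → ℂ)) ⁻¹' openBox p₀ ρ σ := by
    ext z; simp only [mem_setOf_eq, mem_inter_iff, mem_preimage, LinearMap.coe_comp,
      Function.comp_apply, LinearMap.fst_apply, LinearMap.snd_apply, Complex.reLm_coe,
      Complex.imLm_coe, mem_Ioo]; tauto
  rw [h]
  exact (((convex_Ioo α β).linear_preimage _).inter ((convex_Ioo γ δ').linear_preimage _)).inter
    ((convex_openBox p₀ ρ σ).linear_preimage _)

/-- **Cartan's theorem on holomorphic invertible matrices, split form with box parameters**
(Cartan 1940, Théorème I; near the identity GR Kap. III §1.3 Satz 4). As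
`cartan_factorization_polydisc` with the parameter polydiscs replaced by boxes
`openBox p₀ ρ∞ σ∞ ⊂ openBox p₀ ρ σ ⊂ openBox p₀ ρ₁ σ₁`: every `c` holomorphic with invertible values on
`{a' − η < x < b' + η, c − η < y < d + η} × openBox p₀ ρ₁ σ₁` is a product `c = c₁ c₂` on
`{a' < x < b', c + 2ε < y < d − 2ε} × openBox p₀ ρ∞ σ∞` with `c₁`, `c₂` holomorphic and invertible on
`{a < x < b', …}`, `{a' < x < b, …}` (same `y`-strip and parameter box). [cite: Cartan1940, Théorème I] -/
theorem cartan_factorization_box {a a' b' b δ : ℝ} (haa' : a ≤ a') (hb'b : b' ≤ b)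
    (hδ : 0 < δ) (hab : a' + δ < b' - δ) {c d ε : ℝ} (hε : 0 < ε) (hcd : c + 2 * ε ≤ d - 2 * ε)
    (p₀ : ι → ℂ) {ρ₁ ρ ρinf σ₁ σ σinf : ι → ℝ} (hρinf : ∀ i, 0 < ρinf i) (hρ : ∀ i, ρinf i < ρ i)
    (hρ₁ : ∀ i, ρ i < ρ₁ i) (hσinf : ∀ i, 0 < σinf i) (hσ : ∀ i, σinf i < σ i)
    (hσ₁ : ∀ i, σ i < σ₁ i) {η : ℝ} (hη : 0 < η) {cf : ℂ × (ι → ℂ) → 𝔄}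
    (hcf : DifferentiableOn ℂ cf
      {z : ℂ × (ι → ℂ) | a' - η < z.1.re ∧ z.1.re < b' + η ∧ c - η < z.1.im ∧ z.1.im < d + η ∧
        z.2 ∈ openBox p₀ ρ₁ σ₁})
    (hunit : ∀ z : ℂ × (ι → ℂ), a' - η < z.1.re → z.1.re < b' + η → c - η < z.1.im →
      z.1.im < d + η → z.2 ∈ openBox p₀ ρ₁ σ₁ → IsUnit (cf z)) :
    ∃ c₁ c₂ : ℂ × (ι → ℂ) → 𝔄,
      DifferentiableOn ℂ c₁ {z : ℂ × (ι → ℂ) | a < z.1.re ∧ z.1.re < b' ∧ c + 2 * ε < z.1.im ∧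
        z.1.im < d - 2 * ε ∧ z.2 ∈ openBox p₀ ρinf σinf} ∧
      DifferentiableOn ℂ c₂ {z : ℂ × (ι → ℂ) | a' < z.1.re ∧ z.1.re < b ∧ c + 2 * ε < z.1.im ∧
        z.1.im < d - 2 * ε ∧ z.2 ∈ openBox p₀ ρinf σinf} ∧
      (∀ z : ℂ × (ι → ℂ), a < z.1.re → z.1.re < b' → c + 2 * ε < z.1.im → z.1.im < d - 2 * ε →
        z.2 ∈ openBox p₀ ρinf σinf → IsUnit (c₁ z)) ∧
      (∀ z : ℂ × (ι → ℂ), a' < z.1.re → z.1.re < b → c + 2 * ε < z.1.im → z.1.im < d - 2 * ε →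
        z.2 ∈ openBox p₀ ρinf σinf → IsUnit (c₂ z)) ∧
      ∀ z : ℂ × (ι → ℂ), a' < z.1.re → z.1.re < b' → c + 2 * ε < z.1.im → z.1.im < d - 2 * ε →
        z.2 ∈ openBox p₀ ρinf σinf → cf z = c₁ z * c₂ z := by
  -- Cartan's Heftungslemma for this geometry
  obtain ⟨K, β₀, hK1, hβ₀, hCartan⟩ :=
    cartan_heftung_box (𝔄 := 𝔄) haa' hb'b hδ hab hε hcd p₀ hρinf hρ hσinf hσ
  have ha'b' : a' ≤ b' := by linarith
  have hcd' : c ≤ d := by linarith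
  -- the convex open set `U` carrying `c`, the compact convex parameter set `K'`
  set U : Set (ℂ × (ι → ℂ)) := {z : ℂ × (ι → ℂ) | a' - η < z.1.re ∧ z.1.re < b' + η ∧
    c - η < z.1.im ∧ z.1.im < d + η ∧ z.2 ∈ openBox p₀ ρ₁ σ₁} with hUdef
  have hUo : IsOpen U := isOpen_box_prod_openBox _ _ _ _ p₀ ρ₁ σ₁
  have hUc : Convex ℝ U := convex_box_prod_openBox _ _ _ _ p₀ ρ₁ σ₁
  have hunit' : ∀ z ∈ U, IsUnit (cf z) := fun z hz =>
    hunit z hz.1 hz.2.1 hz.2.2.1 hz.2.2.2.1 hz.2.2.2.2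
  set K' : Set (ι → ℂ) := closedBox p₀ ρ σ with hK'def
  have hK'c : IsCompact K' := isCompact_closedBox p₀ ρ σ
  have hK'conv : Convex ℝ K' := convex_closedBox p₀ ρ σ
  have hrK' : openBox p₀ ρ σ ⊆ K' := openBox_subset_closedBox p₀ ρ σ
  have hK'r₁ : K' ⊆ openBox p₀ ρ₁ σ₁ := closedBox_subset_openBox p₀ hρ₁ hσ₁
  have hrinf_r : openBox p₀ ρinf σinf ⊆ openBox p₀ ρ σ :=
    openBox_mono p₀ (fun i => (hρ i).le) (fun i => (hσ i).le)
  have hη2 : 0 < η / 2 := half_pos hη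
  have hsubU : (Icc (a' - η / 2) (b' + η / 2) ×ℂ Icc (c - η / 2) (d + η / 2)) ×ˢ K' ⊆ U := by
    rintro ⟨w, p⟩ ⟨⟨⟨h1, h2⟩, ⟨h3, h4⟩⟩, hp⟩
    exact ⟨by linarith, by linarith, by linarith, by linarith, hK'r₁ hp⟩
  -- `u = c⁻¹` is holomorphic with invertible values on `U`
  have hu_diff : DifferentiableOn ℂ (fun z => Ring.inverse (cf z)) U := fun z hz =>
    (differentiableAt_inverse (hunit' z hz)).comp_differentiableWithinAt z (hcf z hz)
  have hu_unit : ∀ z ∈ U, IsUnit (Ring.inverse (cf z)) := fun z hz =>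
    (hunit' z hz).ringInverse
  -- a bound for `c` on the compact set `[a', b'] × [c, d] × K'`
  set R : Set ℂ := Icc a' b' ×ℂ Icc c d with hRdef
  have hRK'U : R ×ˢ K' ⊆ U := by
    rintro ⟨w, p⟩ ⟨⟨⟨h1, h2⟩, ⟨h3, h4⟩⟩, hp⟩
    exact ⟨by linarith, by linarith, by linarith, by linarith, hK'r₁ hp⟩
  obtain ⟨M₀, hM₀⟩ := ((isCompact_Icc.reProdIm isCompact_Icc).prod hK'c).exists_bound_of_continuousOn
    (f := cf) (hcf.continuousOn.mono hRK'U)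
  set M : ℝ := max M₀ 0 with hMdef
  have hM0 : 0 ≤ M := le_max_right _ _
  have hM : ∀ z ∈ R ×ˢ K', ‖cf z‖ ≤ M := fun z hz => (hM₀ z hz).trans (le_max_left _ _)
  -- Runge for `u` with tolerance `δ₂`
  set δ₂ : ℝ := β₀ / (M + 1) with hδ₂
  have hδ₂0 : 0 < δ₂ := by positivity
  obtain ⟨û, V, hVo, hKV, hûd, hûu, hû⟩ := runge_units_rectangle_param hUo hUc hu_diff hu_unit
    ha'b' hcd' hη2 hK'c hK'conv hsubU hδ₂0
  -- `af = c û` is close to `1` on the open overlap box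
  set af : ℂ × (ι → ℂ) → 𝔄 := fun z => cf z * û z with haf
  have hDU : {z : ℂ × (ι → ℂ) | a' < z.1.re ∧ z.1.re < b' ∧ c < z.1.im ∧ z.1.im < d ∧
      z.2 ∈ openBox p₀ ρ σ} ⊆ U := fun z hz =>
    ⟨by linarith [hz.1], by linarith [hz.2.1], by linarith [hz.2.2.1], by linarith [hz.2.2.2.1],
      hK'r₁ (hrK' hz.2.2.2.2)⟩
  have hDV : {z : ℂ × (ι → ℂ) | a' < z.1.re ∧ z.1.re < b' ∧ c < z.1.im ∧ z.1.im < d ∧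
      z.2 ∈ openBox p₀ ρ σ} ⊆ univ ×ˢ V := fun z hz => ⟨mem_univ _, hKV (hrK' hz.2.2.2.2)⟩
  have haf_diff : DifferentiableOn ℂ af {z : ℂ × (ι → ℂ) | a' < z.1.re ∧ z.1.re < b' ∧
      c < z.1.im ∧ z.1.im < d ∧ z.2 ∈ openBox p₀ ρ σ} := (hcf.mono hDU).mul (hûd.mono hDV)
  have hN : M * δ₂ ≤ β₀ := by
    rw [hδ₂, mul_div_assoc', div_le_iff₀ (by positivity)]
    nlinarith
  have haf_bound : ∀ z : ℂ × (ι → ℂ), a' < z.1.re → z.1.re < b' → c < z.1.im → z.1.im < d →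
      z.2 ∈ openBox p₀ ρ σ → ‖af z - 1‖ ≤ M * δ₂ := by
    intro z h1 h2 h3 h4 h5
    have hzU : z ∈ U := hDU ⟨h1, h2, h3, h4, h5⟩
    have hzR : z.1 ∈ R := ⟨⟨h1.le, h2.le⟩, ⟨h3.le, h4.le⟩⟩
    have hzK : z.2 ∈ K' := hrK' h5
    have hid : af z - 1 = cf z * (û z - Ring.inverse (cf z)) := by
      simp only [haf]
      rw [mul_sub, Ring.mul_inverse_cancel _ (hunit' z hzU)]
    rw [hid]
    refine (norm_mul_le _ _).trans (mul_le_mul (hM z ⟨hzR, hzK⟩) ?_ (norm_nonneg _) hM0)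
    rw [norm_sub_rev]
    have := hû z.1 hzR z.2 hzK
    simpa using this
  -- Cartan's Heftungslemma: `af = c₁ c₂'`
  obtain ⟨c₁, c₂, hc₁d, hc₂d, hc₁u, hc₂u, hfac⟩ :=
    hCartan af (M * δ₂) (by positivity) hN haf_diff haf_bound
  have hBV : {z : ℂ × (ι → ℂ) | a' < z.1.re ∧ z.1.re < b ∧ c + 2 * ε < z.1.im ∧
      z.1.im < d - 2 * ε ∧ z.2 ∈ openBox p₀ ρinf σinf} ⊆ univ ×ˢ V := fun z hz =>
    ⟨mem_univ _, hKV (hrK' (hrinf_r hz.2.2.2.2))⟩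
  refine ⟨c₁, fun z => c₂ z * Ring.inverse (û z), hc₁d, ?_, fun z h1 h2 h3 h4 h5 =>
    (hc₁u z h1 h2 h3 h4 h5).1, ?_, ?_⟩
  · refine hc₂d.mul fun z hz => ?_
    have hzV : z ∈ univ ×ˢ V := hBV hz
    exact (differentiableAt_inverse (hûu z hzV)).comp_differentiableWithinAt z
      ((hûd z hzV).mono hBV)
  · intro z h1 h2 h3 h4 h5
    exact (hc₂u z h1 h2 h3 h4 h5).1.mul (hûu z (hBV ⟨h1, h2, h3, h4, h5⟩)).ringInverse
  · intro z h1 h2 h3 h4 h5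
    have hzV : z ∈ univ ×ˢ V := hBV ⟨h1, by linarith, h3, h4, h5⟩
    have h' := hfac z h1 h2 h3 h4 h5
    simp only [haf] at h'
    calc cf z = cf z * û z * Ring.inverse (û z) := by
          rw [mul_assoc, Ring.mul_inverse_cancel _ (hûu z hzV), mul_one]
      _ = c₁ z * (c₂ z * Ring.inverse (û z)) := by rw [h', mul_assoc]

end Cartan

end Literature.Analysis.Complex
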